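import Literature.RepresentationTheory.HeisenbergGroup.ImplementerCocycleClass
import Literature.RepresentationTheory.HeisenbergGroup.SymplecticAbelianization
import Literature.RepresentationTheory.HeisenbergGroup.SchrodingerPiGeneration
import Literature.NumberTheory.Weil1964.LocalLerayCocycleTransport
import HarnessLib

/-!
# Rigidity of normalised implementer sections: a section is determined by its cocycle; equivariance under `Sp`

Topic `RepresentationTheory/HeisenbergGroup`; namespace `Literature.RepresentationTheory.HeisenbergGroup`. KERNEL
mathematics only (definitions with bodies + theorems; no named fact, no `axiom`, no `sorry`). Sequel of
`ImplementerCocycleClass.lean` (`c_{r'} = c_r · ∂ν`, `ν = r / r'`) and `SymplecticAbelianization.lean` (`Sp` is perfect).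

* §1 **two normalised sections of implementers with the SAME cocycle are EQUAL** as soon as `Sp(V, B)` has no
  non-trivial character to `kˣ` (`ImplementerSection.eq_of_cocycle_eq`): `c_{r'} = c_r · ∂ν` with `c_{r'} = c_r` makes
  `ν = r/r'` a homomorphism `Sp(V,B) → kˣ` (`sectionRatioHom`), hence trivial — [Rangarao1993] §3.5 / [MoeglinVignerasWaldspurger1987]
  Chap. 2 II.1–II.2 (the metaplectic group has a unique section with a prescribed admissible cocycle since `Sp` is
  its own commutator subgroup); [Folland1989] Prop. (4.21).
* §2 **conjugating a section by an implementer**: for `δ ∈ Sp(V,B)` and an implementer `M` of `δ`,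
  `g ↦ M⁻¹ r'(δ g δ⁻¹) M` is a normalised section (`ImplementerSection.conjBy`) with cocycle
  `(g, g') ↦ c_{r'}(δgδ⁻¹, δg'δ⁻¹)` (`cocycle_conjBy`); hence (§1) **if `c_{r'}(δgδ⁻¹, δg'δ⁻¹) = c_r(g, g')` then
  `r'(δ g δ⁻¹) = r(δ) r(g) r(δ)⁻¹`** (`apply_conj_eq_of_cocycle_eq`).
* §3 **Leray-normalised sections are `Sp`-equivariant in the Lagrangian**: over a non-archimedean local field, if
  `c_r = c_ℓ` and `c_{r'} = c_{δℓ}` (Leray cocycles of the Lagrangians `ℓ` and `δℓ`, any character, any Haar measure) then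
  `r'(δ g δ⁻¹) = r(δ) r(g) r(δ)⁻¹` (`leraySection_apply_conj`; `c_{δℓ}(δgδ⁻¹, δg'δ⁻¹) = c_ℓ(g, g')` is
  `Weil1964.lerayCocycle_conj`) — [Rangarao1993] Thm 3.5 (2) / Lemma 5.1 ("`σ ↦ r_{Lσ}` is `Sp`-equivariant"),
  [LionVergne1980] 1.6.18.
* §4 the hypothesis of §1 for the symplectic group of a Gram duality `β_T = ⟨x, T y⟩` over a field of characteristic `0`
  (`monoidHom_symplecticGroup_gram_eq_one`: `Sp_{2ι}(K) → Sp(W, A_T)` is onto, `SymplecticMatrix.transportSp_surjective`,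
  and `Sp_{2ι}(K)` is perfect, `SymplecticMatrix.hom_eq_one`).

## References

* [Rangarao1993] R. Ranga Rao, Pacific J. Math. 157 (1993) 335–371: §3.5, Thm 3.5, Lemma 5.1.
* [MoeglinVignerasWaldspurger1987] C. Mœglin, M.-F. Vignéras, J.-L. Waldspurger, LNM 1291 (1987), Chap. 2 II.1–II.2.
* [Folland1989] G. B. Folland, *Harmonic Analysis in Phase Space*, Prop. (4.21).
* [LionVergne1980] G. Lion, M. Vergne, Progress in Math. 6 (1980), §1.6.18.
-/

set_option autoImplicit false

noncomputable section

namespace Literature.RepresentationTheory.HeisenbergGroup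

open Literature.GroupTheory

universe u v u' v'

section General

variable {R : Type u} [CommRing R] [Invertible (2 : R)] {V : Type v} [AddCommGroup V] [Module R V]
  {B : V →ₗ[R] V →ₗ[R] R}
variable {k : Type u'} [Field k] {S : Type v'} [AddCommGroup S] [Module k S]
variable {ρ : Representation k (Heisenberg B) S}

namespace ImplementerSection

/-! ## §1 A normalised section is determined by its cocycle (when `Sp` has no characters) -/

/-- two sections with the same operators are equal. [folklore] -/
private theorem ext' {r r' : ImplementerSection ρ} (h : ∀ g, r g = r' g) : r = r' := by
  cases r with
  | mk f hf h1 =>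
    cases r' with
    | mk f' hf' h1' =>
      have : f = f' := funext h
      subst this
      rfl

variable (r r' : ImplementerSection ρ) (hU : ImplementerUniqueUpToScalar ρ) [Nontrivial S]

/-- **if `c_r = c_{r'}` then the ratio `ν = r / r'` is multiplicative**: `ν(gg') = ν(g) ν(g')`
(from `c_{r'} = c_r ν(gg') ν(g)⁻¹ ν(g')⁻¹`). [cite: MoeglinVignerasWaldspurger1987, Chap. 2 II.1 (A)–(B); Rangarao1993, §3.5] -/
theorem sectionRatio_mul_of_cocycle_eq (h : r.cocycle hU = r'.cocycle hU) (g g' : symplecticGroup B) :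
    sectionRatio r r' hU (g * g') = sectionRatio r r' hU g * sectionRatio r r' hU g' := by
  have e := congrArg (fun c : CentralCocycle (symplecticGroup B) kˣ => c g g') (cocycle_eq_twist r r' hU)
  simp only [CentralCocycle.twist_apply] at e
  rw [← h] at e
  -- `c = c ν(gg') ν(g)⁻¹ ν(g')⁻¹`
  have e' : sectionRatio r r' hU (g * g') * (sectionRatio r r' hU g)⁻¹ * (sectionRatio r r' hU g')⁻¹ = 1 := by
    have := congrArg (fun x => (r.cocycle hU g g')⁻¹ * x) e
    simpa only [inv_mul_cancel, ← mul_assoc, inv_mul_cancel, one_mul] using this.symm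
  have h1 : sectionRatio r r' hU (g * g') * (sectionRatio r r' hU g)⁻¹ = sectionRatio r r' hU g' :=
    mul_inv_eq_one.1 e'
  rw [mul_inv_eq_iff_eq_mul.1 h1, mul_comm]

/-- **the ratio of two sections with the same cocycle, as a character `Sp(V,B) →* kˣ`**.
[cite: MoeglinVignerasWaldspurger1987, Chap. 2 II.1 (A)–(B); Rangarao1993, §3.5] -/
def sectionRatioHom (h : r.cocycle hU = r'.cocycle hU) : symplecticGroup B →* kˣ where
  toFun := sectionRatio r r' hU
  map_one' := sectionRatio_one r r' hU
  map_mul' := sectionRatio_mul_of_cocycle_eq r r' hU h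

/-- formula. [cite: MoeglinVignerasWaldspurger1987, Chap. 2 II.1 (A)–(B)] -/
@[simp] theorem sectionRatioHom_apply (h : r.cocycle hU = r'.cocycle hU) (g : symplecticGroup B) :
    sectionRatioHom r r' hU h g = sectionRatio r r' hU g := rfl

/-- **RIGIDITY: two normalised sections of implementers with the same cocycle are equal**, provided `Sp(V,B)` has
no non-trivial homomorphism to `kˣ` (e.g. `Sp` perfect). [cite: Rangarao1993, §3.5 and Thm 3.5; MoeglinVignerasWaldspurger1987, Chap. 2 II.2; Folland1989, §4.1 Prop. (4.21)] -/
theorem eq_of_cocycle_eq (htriv : ∀ χ : symplecticGroup B →* kˣ, χ = 1) (h : r.cocycle hU = r'.cocycle hU) :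
    r = r' := by
  refine ext' fun g => LinearEquiv.ext fun f => ?_
  have hν : sectionRatio r r' hU g = 1 := by
    rw [← sectionRatioHom_apply r r' hU h g, htriv (sectionRatioHom r r' hU h), MonoidHom.one_apply]
  have := apply_eq_sectionRatio_smul r r' hU g f
  rwa [hν, Units.val_one, one_smul] at this

/-- pointwise form of the rigidity. [cite: Rangarao1993, §3.5 and Thm 3.5] -/
theorem apply_eq_of_cocycle_eq (htriv : ∀ χ : symplecticGroup B →* kˣ, χ = 1) (h : r.cocycle hU = r'.cocycle hU)
    (g : symplecticGroup B) (f : S) : r g f = r' g f := by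
  rw [eq_of_cocycle_eq r r' hU htriv h]

/-! ## §2 Conjugating a section by an implementer of `δ ∈ Sp(V,B)` -/

variable (δ : symplecticGroup B) (M : S ≃ₗ[k] S) (hM : Implements ρ (ofSymplectic B δ) M)

omit [Nontrivial S] in
/-- **the conjugated section `g ↦ M⁻¹ r'(δ g δ⁻¹) M`** for an implementer `M` of `δ`: again a normalised section of
implementers (`M⁻¹ r'(δgδ⁻¹) M` implements `δ⁻¹ (δ g δ⁻¹) δ = g`). [cite: Rangarao1993, Lemma 5.1, Thm 3.5 (2)] -/
def conjBy : ImplementerSection ρ where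
  toFun g := M⁻¹ * r' (δ * g * δ⁻¹) * M
  implements' g := by
    have h := Implements.mul ρ (Implements.mul ρ (Implements.inv ρ hM) (r'.implements (δ * g * δ⁻¹))) hM
    rwa [← map_inv, ← map_mul, ← map_mul, show δ⁻¹ * (δ * g * δ⁻¹) * δ = g by group] at h
  map_one' := by rw [mul_one, mul_inv_cancel, r'.map_one, mul_one, inv_mul_cancel]

omit [Nontrivial S] in
/-- formula. [cite: Rangarao1993, Lemma 5.1] -/
@[simp] theorem conjBy_apply (g : symplecticGroup B) (f : S) :
    r'.conjBy δ M hM g f = M.symm (r' (δ * g * δ⁻¹) (M f)) := rfl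

/-- **the cocycle of the conjugated section**: `c_{conj r'}(g, g') = c_{r'}(δgδ⁻¹, δg'δ⁻¹)`.
[cite: Rangarao1993, Lemma 5.1, Thm 3.5 (2)] -/
theorem cocycle_conjBy (g g' : symplecticGroup B) :
    (r'.conjBy δ M hM).cocycle hU g g' = r'.cocycle hU (δ * g * δ⁻¹) (δ * g' * δ⁻¹) := by
  rw [cocycle_apply, cocycle_apply]
  refine ((r'.conjBy δ M hM).cocycleFun_unique hU fun f => ?_).symm
  rw [conjBy_apply, conjBy_apply, conjBy_apply, LinearEquiv.apply_symm_apply, r'.mul_apply hU, map_smul,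
    show δ * g * δ⁻¹ * (δ * g' * δ⁻¹) = δ * (g * g') * δ⁻¹ by group]

/-- **if `c_{r'}(δgδ⁻¹, δg'δ⁻¹) = c_r(g, g')` for all `g, g'`, then `r'(δ g δ⁻¹) = r(δ) r(g) r(δ)⁻¹`** (`Sp(V,B)`
without characters): conjugate `r'` by the implementer `r(δ)` and apply the rigidity of §1.
[cite: Rangarao1993, Lemma 5.1, Thm 3.5 (2); MoeglinVignerasWaldspurger1987, Chap. 2 II.2] -/
theorem apply_conj_eq_of_cocycle_eq (htriv : ∀ χ : symplecticGroup B →* kˣ, χ = 1)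
    (h : ∀ g g' : symplecticGroup B, r'.cocycle hU (δ * g * δ⁻¹) (δ * g' * δ⁻¹) = r.cocycle hU g g')
    (g : symplecticGroup B) : r' (δ * g * δ⁻¹) = r δ * r g * (r δ)⁻¹ := by
  have hs : r'.conjBy δ (r δ) (r.implements δ) = r :=
    eq_of_cocycle_eq _ _ hU htriv (CentralCocycle.ext fun g g' => by rw [cocycle_conjBy, h])
  have e : ∀ f, (r δ).symm (r' (δ * g * δ⁻¹) (r δ f)) = r g f := fun f => by
    rw [← conjBy_apply r' δ (r δ) (r.implements δ) g f, hs]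
  refine LinearEquiv.ext fun f => ?_
  rw [LinearEquiv.mul_apply, LinearEquiv.mul_apply, LinearEquiv.coe_inv]
  have := e ((r δ).symm f)
  rw [LinearEquiv.apply_symm_apply, LinearEquiv.symm_apply_eq] at this
  exact this

/-- the same, read as `r'(δgδ⁻¹) r(δ) = r(δ) r(g)`. [cite: Rangarao1993, Lemma 5.1, Thm 3.5 (2)] -/
theorem apply_conj_mul_eq_of_cocycle_eq (htriv : ∀ χ : symplecticGroup B →* kˣ, χ = 1)
    (h : ∀ g g' : symplecticGroup B, r'.cocycle hU (δ * g * δ⁻¹) (δ * g' * δ⁻¹) = r.cocycle hU g g')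
    (g : symplecticGroup B) : r' (δ * g * δ⁻¹) * r δ = r δ * r g := by
  rw [apply_conj_eq_of_cocycle_eq r r' hU δ htriv h g, inv_mul_cancel_right]

end ImplementerSection

end General

/-! ## §3 Leray-normalised sections are `Sp`-equivariant in the Lagrangian -/

section Leray

open _root_.MeasureTheory
open Literature.NumberTheory.Weil1964

variable {F : Type*} [Field F] [ValuativeRel F] [TopologicalSpace F] [IsNonarchimedeanLocalField F]
  [MeasurableSpace F] [BorelSpace F] (μ : Measure F) [μ.IsAddHaarMeasure] {ψ : AddChar F Circle}
  [Invertible (2 : F)]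
variable {V : Type*} [AddCommGroup V] [Module F V] [FiniteDimensional F V] {β : V →ₗ[F] V →ₗ[F] F}
variable {S : Type*} [AddCommGroup S] [Module ℂ S] [Nontrivial S] {ρ : Representation ℂ (Heisenberg β) S}

omit [ValuativeRel F] [TopologicalSpace F] [IsNonarchimedeanLocalField F] [MeasurableSpace F] [BorelSpace F]
  [Invertible (2 : F)] [FiniteDimensional F V] in
/-- the coerced conjugate: `((δ g δ⁻¹ : Sp) : V ≃ V) = δ⁻¹ ≫ g ≫ δ` as linear equivalences. [folklore] -/
private theorem coe_conj_eq_trans (δ g : symplecticGroup β) :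
    ((δ * g * δ⁻¹ : symplecticGroup β) : V ≃ₗ[F] V) =
      (δ : V ≃ₗ[F] V).symm ≪≫ₗ (g : V ≃ₗ[F] V) ≪≫ₗ (δ : V ≃ₗ[F] V) := by
  refine LinearEquiv.ext fun x => ?_
  simp only [Subgroup.coe_mul, Subgroup.coe_inv, LinearEquiv.mul_apply, LinearEquiv.coe_inv, LinearEquiv.trans_apply]

omit [ValuativeRel F] [TopologicalSpace F] [IsNonarchimedeanLocalField F] [MeasurableSpace F] [BorelSpace F]
  [Invertible (2 : F)] in
/-- a symplectic `δ` maps a Lagrangian of `A = alt β` to a Lagrangian. [cite: LionVergne1980, §1.1.3–1.1.4, §1.5.2] -/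
theorem orthogonal_map_symplectic_eq_self (hN : (alt β).Nondegenerate) {ℓ : Submodule F V}
    (hℓ : LinearMap.BilinForm.orthogonal (alt β) ℓ = ℓ) (δ : symplecticGroup β) :
    LinearMap.BilinForm.orthogonal (alt β) (ℓ.map ((δ : V ≃ₗ[F] V) : V →ₗ[F] V)) =
      ℓ.map ((δ : V ≃ₗ[F] V) : V →ₗ[F] V) :=
  orthogonal_map_eq_self hN hℓ _ δ.2

/-- **`Sp`-EQUIVARIANCE OF LERAY-NORMALISED SECTIONS**: if `r` has cocycle the Leray cocycle of the Lagrangian `ℓ` and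
`r'` that of `δℓ` (`δ ∈ Sp(V, A)`, same character and measure), then `r'(δ g δ⁻¹) = r(δ) r(g) r(δ)⁻¹` for every `g` —
provided `Sp(V, A)` has no characters. [cite: Rangarao1993, Lemma 5.1, Thm 3.5 (2); LionVergne1980, §1.6.18] -/
theorem leraySection_apply_conj (htriv : ∀ χ : symplecticGroup β →* ℂˣ, χ = 1) (hψ : ψ.IsContinuousNontrivial)
    (hA : (alt β).IsAlt) (hN : (alt β).Nondegenerate) {ℓ : Submodule F V}
    (hℓ : LinearMap.BilinForm.orthogonal (alt β) ℓ = ℓ)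
    (δ : symplecticGroup β) (hU : ImplementerUniqueUpToScalar ρ) (r r' : ImplementerSection ρ)
    (hr : r.cocycle hU = lerayCentralCocycle μ hψ hA hN hℓ)
    (hr' : r'.cocycle hU = lerayCentralCocycle μ hψ hA hN (orthogonal_map_symplectic_eq_self hN hℓ δ))
    (g : symplecticGroup β) : r' (δ * g * δ⁻¹) = r δ * r g * (r δ)⁻¹ := by
  refine ImplementerSection.apply_conj_eq_of_cocycle_eq r r' hU δ htriv (fun g g' => Units.ext ?_) g
  rw [hr, hr']
  change lerayCocycle ψ μ (alt β) (ℓ.map ((δ : V ≃ₗ[F] V) : V →ₗ[F] V)) ((δ * g * δ⁻¹ : symplecticGroup β) : V ≃ₗ[F] V)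
      ((δ * g' * δ⁻¹ : symplecticGroup β) : V ≃ₗ[F] V) = lerayCocycle ψ μ (alt β) ℓ (g : V ≃ₗ[F] V) (g' : V ≃ₗ[F] V)
  rw [coe_conj_eq_trans, coe_conj_eq_trans]
  exact lerayCocycle_conj μ (δ : V ≃ₗ[F] V) δ.2 hψ ℓ _ _

end Leray

/-! ## §4 `Sp(W, A_T)` has no characters (Gram dualities over a field of characteristic `0`) -/

section Gram

variable {K : Type*} [Field K] [CharZero K] {ι : Type*} [Fintype ι] [DecidableEq ι] (T : Matrix ι ι K)
  (hT : IsUnit T.det) {A : Type*} [CommGroup A]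

include hT in
/-- **every homomorphism `Sp(W, A_T) → A` to a commutative group is trivial** (`W = K^ι × K^ι`, `A_T` the form of
the duality `⟨x, T y⟩`, `det T` a unit, `char K = 0`): `Sp_{2ι}(K) ↠ Sp(W, A_T)` and `Sp_{2ι}(K)` is perfect.
[cite: Folland1989, §4.1 Prop. (4.21); MoeglinVignerasWaldspurger1987, Chap. 2 II.2] -/
theorem monoidHom_symplecticGroup_gram_eq_one (χ : symplecticGroup (polar (Matrix.toLinearMap₂' K T)) →* A) : χ = 1 :=
  SymplecticMatrix.hom_eq_one_of_surjective (SymplecticMatrix.transportSp T hT) (transportSp_surjective T hT) χ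

/-- in particular for the standard duality `⟨x, y⟩` (`T = 1`). [cite: Folland1989, §4.1 Prop. (4.21)] -/
theorem monoidHom_symplecticGroup_pi_eq_one (χ : symplecticGroup (polar (dotProductBilin K K (m := ι))) →* A) : χ = 1 :=
  SymplecticMatrix.hom_eq_one_of_surjective (transportSpPi K ι) (transportSpPi_surjective K ι) χ

end Gram

end Literature.RepresentationTheory.HeisenbergGroup
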